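import Summits.NavierStokesRegularity.NavierStokesRegularity.Theorems.EulerZoomLiouvillePowerGaugeEulerLiouvilleWeakPressureGradientMember

/-!
# THE LAMB FORM (CIV (3.29)) IN THE WEAK CLASS: the Bernoulli function of a weak class profile is `W^{1,1}_loc` with
# `∇ℋ = −(1−2γ)W − Ω × W` a.e.
# (crux `EulerZoomLiouville.PowerGaugeEulerLiouville` = stmt-NavierStokesRegularity-19832, line `birth`, open stub `stub_selfSimilarWeakRest`)

Width seat `ns-ezl-w1` (g6) under the crux LEAD, cell ns-regularity-ideate.  TOOL for the genuinely weak exactly-self-similar stratum; sequel of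
`…WeakBernoulliTransport*` (CIV (3.31) in `𝒟′`) and `…WeakPressureGradient*` (CIV (3.3) a.e.: `∇P = −(1−γ)V − DV·W`).

For a `C²` profile, Constantin–Ignatova–Vicol (3.29) rewrite the profile equation as `(1−2γ)W + Ω × W + ∇ℋ = 0` (`W = γy + V`, `Ω = curl V`,
`ℋ = ½|W|² + P + ½γ(γ−1)|y|²`).  In the weak class `V` has a whole-space weak gradient `G ∈ L²_loc`, so `Ω × a = (G − Gᵀ)a` is an `L²_loc` object and
(3.29) makes sense a.e.; this file proves it in the form

  `Dℋ(x) v = (2γ−1)⟪W x, v⟫ + ⟪W x, G(x) v⟫ − ⟪G(x)(W x), v⟫`   (`= −(1−2γ)⟪W,v⟫ − ⟪(G − Gᵀ)W, v⟫`),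

as a `HasWeakFDerivOn ⊤ volume` statement, from the weak pressure-gradient law (`WeakPressure.hasWeakFDerivOn_pressure`), the chain rule
`D|W|² = 2⟪W, DW⟫` for `W ∈ W^{1,2}` on balls (`hasWeakFDerivOn_norm_sq`) and linearity; the ball statements are glued to the whole space test
function by test function.

* `WeakBernoulli.hasWeakFDerivOn_transport` — `W` has the weak derivative `γ·id + G` wherever `V` has `G`;
* `WeakBernoulli.hasWeakFDerivOn_bernoulli_ball` — the Lamb form on every ball `B(0, R)`;
* **`WeakBernoulli.hasWeakFDerivOn_bernoulli`** — the Lamb form on `ℝ³` (profile level: `V ∈ L⁶_loc`, `G ∈ L²_loc`, and the weak pressure-gradient law);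
* **`WeakBernoulli.hasWeakFDerivOn_bernoulli_of_selfSimilar`** — MEMBER LEVEL: crux hypotheses verbatim + exact self-similarity about the origin
  (`0 < ρ ≤ ½`) ⇒ some whole-space weak derivative `G` of `V` (`L²` on balls) for which the Lamb form holds — `ℋ ∈ W^{1,1}_loc` with the displayed
  gradient, NO regularity of the profile.

WHAT THIS IS NOT: not NS, not E, not the stub — a weak-class TOOL (`--supports` stmt-19832): with `∇ℋ` in hand, truncation / level-set arguments on
`{ℋ > h}` become available to `stub_selfSimilarWeakRest` (what the weak stratum still lacks against the `C²` needle is the flow).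
[folklore; cf. ConstantinIgnatovaVicol2026Putative §3.4.3 (3.29)–(3.30)]
-/

noncomputable section

set_option linter.dupNamespace false
-- nested operator types (`innerSL … ∘L …`)
set_option maxSynthPendingDepth 3

open MeasureTheory Set Filter Topology Metric Function TopologicalSpace
open scoped ENNReal NNReal RealInnerProductSpace ContDiff

namespace Summit.NavierStokesRegularity.NavierStokesRegularity.Theorems.PowerGaugeEulerLiouville

open Literature.Analysis Literature.Analysis.FunctionSpaces Literature.Analysis.FluidPDE

namespace WeakBernoulli

variable {V : EuclideanSpace ℝ (Fin 3) → EuclideanSpace ℝ (Fin 3)} {P : EuclideanSpace ℝ (Fin 3) → ℝ}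
  {G : EuclideanSpace ℝ (Fin 3) → EuclideanSpace ℝ (Fin 3) →L[ℝ] EuclideanSpace ℝ (Fin 3)}

/-- **`W = γy + V` has the weak derivative `γ·id + G`** on every open set where `V` has the weak derivative `G`. [folklore] -/
theorem hasWeakFDerivOn_transport {γ : ℝ} {U : Opens (EuclideanSpace ℝ (Fin 3))} (hVG : HasWeakFDerivOn U volume V G) :
    HasWeakFDerivOn U volume (selfSimilarTransport γ 0 V)
      (fun x => γ • ContinuousLinearMap.id ℝ (EuclideanSpace ℝ (Fin 3)) + G x) := by
  have hlin : ContDiff ℝ 1 (fun x : EuclideanSpace ℝ (Fin 3) => γ • (x - 0)) := by fun_prop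
  have h1 := HasWeakFDerivOn.of_contDiff_holds U (volume : Measure (EuclideanSpace ℝ (Fin 3))) hlin
  have e1 : (fderiv ℝ fun x : EuclideanSpace ℝ (Fin 3) => γ • (x - 0)) =
      fun _ => γ • ContinuousLinearMap.id ℝ (EuclideanSpace ℝ (Fin 3)) := by
    funext x
    exact (((hasFDerivAt_id x).sub_const (0 : EuclideanSpace ℝ (Fin 3))).const_smul γ).fderiv
  rw [e1] at h1
  have h := h1.sub (hVG.const_smul (-1 : ℝ))
  have e2 : ((fun x : EuclideanSpace ℝ (Fin 3) => γ • (x - 0)) - (-1 : ℝ) • V) = selfSimilarTransport γ 0 V := by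
    funext x
    simp only [Pi.sub_apply, Pi.neg_apply, selfSimilarTransport_apply, neg_smul, one_smul, sub_neg_eq_add]
  have e3 : ((fun _ : EuclideanSpace ℝ (Fin 3) => γ • ContinuousLinearMap.id ℝ (EuclideanSpace ℝ (Fin 3))) - (-1 : ℝ) • G) =
      fun x => γ • ContinuousLinearMap.id ℝ (EuclideanSpace ℝ (Fin 3)) + G x := by
    funext x
    simp only [Pi.sub_apply, Pi.neg_apply, neg_smul, one_smul, sub_neg_eq_add]
  rw [e2, e3] at h
  exact h

/-- The Bernoulli function about the origin as a combination of `|W|²`, `P`, `|y|²` (functions). [folklore] -/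
theorem bernoulli_eq_smul_add {γ : ℝ} :
    selfSimilarBernoulli γ 0 V P =
      ((1 / 2 : ℝ) • fun y => ‖selfSimilarTransport γ 0 V y‖ ^ 2) - (-1 : ℝ) • P -
        (-(γ * (γ - 1) / 2)) • fun y : EuclideanSpace ℝ (Fin 3) => ‖y‖ ^ 2 := by
  funext y
  simp only [Pi.sub_apply, Pi.smul_apply, smul_eq_mul, selfSimilarBernoulli_apply, selfSimilarTransport_apply, sub_zero]
  ring

/-- **THE LAMB FORM ON A BALL.**  `V ∈ L⁶(B(0,r))` for all `r`, whole-space weak gradient `G` with `G ∈ L²(B(0,r))` for all `r`, and the weak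
pressure-gradient law `∇P = −(1−γ)V − G(W)`; then on `B(0, R)` the Bernoulli function `ℋ = selfSimilarBernoulli γ 0 V P` has the weak derivative
`v ↦ (2γ−1)⟪W x, v⟫ + ⟪W x, G x v⟫ − ⟪G x (W x), v⟫`. [folklore; cf. ConstantinIgnatovaVicol2026Putative §3.4.3 (3.29)] -/
theorem hasWeakFDerivOn_bernoulli_ball {γ : ℝ}
    (hV6 : ∀ r : ℝ, MemLp V 6 (volume.restrict (ball (0 : EuclideanSpace ℝ (Fin 3)) r)))
    (hVG : HasWeakFDerivOn (⊤ : Opens (EuclideanSpace ℝ (Fin 3))) volume V G)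
    (hG2 : ∀ r : ℝ, MemLp G 2 (volume.restrict (ball (0 : EuclideanSpace ℝ (Fin 3)) r)))
    (hP : HasWeakFDerivOn (⊤ : Opens (EuclideanSpace ℝ (Fin 3))) volume P
      (fun x => -(innerSL ℝ (G x (selfSimilarTransport γ 0 V x) + (1 - γ) • V x)))) (R : ℝ) :
    HasWeakFDerivOn (⟨ball (0 : EuclideanSpace ℝ (Fin 3)) R, isOpen_ball⟩ : Opens (EuclideanSpace ℝ (Fin 3))) volume
      (selfSimilarBernoulli γ 0 V P)
      (fun x => (2 * γ - 1) • innerSL ℝ (selfSimilarTransport γ 0 V x) +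
        (innerSL ℝ (selfSimilarTransport γ 0 V x)).comp (G x) - innerSL ℝ (G x (selfSimilarTransport γ 0 V x))) := by
  set U : Opens (EuclideanSpace ℝ (Fin 3)) := ⟨ball (0 : EuclideanSpace ℝ (Fin 3)) R, isOpen_ball⟩ with hUdef
  have hUB : (U : Set (EuclideanSpace ℝ (Fin 3))) = ball 0 R := rfl
  haveI hfin : IsFiniteMeasure ((volume : Measure (EuclideanSpace ℝ (Fin 3))).restrict (ball (0 : EuclideanSpace ℝ (Fin 3)) R)) :=
    isFiniteMeasure_restrict.2 measure_ball_lt_top.ne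
  -- `W` on the ball: weak derivative and square integrability
  have hWU : HasWeakFDerivOn U volume (selfSimilarTransport γ 0 V)
      (fun x => γ • ContinuousLinearMap.id ℝ (EuclideanSpace ℝ (Fin 3)) + G x) :=
    hasWeakFDerivOn_transport (HasWeakFDerivOn.mono_set_holds hVG le_top)
  have hV2 : MemLp V 2 (volume.restrict (ball (0 : EuclideanSpace ℝ (Fin 3)) R)) := (hV6 R).mono_exponent (by norm_num)
  have hlin2 : MemLp (fun x : EuclideanSpace ℝ (Fin 3) => γ • (x - 0)) 2 (volume.restrict (ball (0 : EuclideanSpace ℝ (Fin 3)) R)) := by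
    refine MemLp.of_bound (by fun_prop : Continuous fun x : EuclideanSpace ℝ (Fin 3) => γ • (x - 0)).aestronglyMeasurable
      (|γ| * R) ?_
    filter_upwards [ae_restrict_mem measurableSet_ball] with x hx
    rw [mem_ball, dist_zero_right] at hx
    rw [norm_smul, Real.norm_eq_abs, sub_zero]
    exact mul_le_mul_of_nonneg_left hx.le (abs_nonneg _)
  have hW2 : MemLp (selfSimilarTransport γ 0 V) 2 (volume.restrict (U : Set (EuclideanSpace ℝ (Fin 3)))) := by
    have h := hlin2.add hV2
    have e : ((fun x : EuclideanSpace ℝ (Fin 3) => γ • (x - 0)) + V) = selfSimilarTransport γ 0 V := by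
      funext x; rfl
    rw [e] at h
    exact h
  have hDW2 : ∀ v, MemLp (fun x => (γ • ContinuousLinearMap.id ℝ (EuclideanSpace ℝ (Fin 3)) + G x) v) 2
      (volume.restrict (U : Set (EuclideanSpace ℝ (Fin 3)))) := by
    intro v
    have h1 : MemLp (fun _ : EuclideanSpace ℝ (Fin 3) => γ • v) 2 (volume.restrict (ball (0 : EuclideanSpace ℝ (Fin 3)) R)) :=
      memLp_const _
    have h2 : MemLp (fun x => G x v) 2 (volume.restrict (ball (0 : EuclideanSpace ℝ (Fin 3)) R)) :=
      (ContinuousLinearMap.apply ℝ (EuclideanSpace ℝ (Fin 3)) v).comp_memLp' (hG2 R)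
    have h := h1.add h2
    have e : ((fun _ : EuclideanSpace ℝ (Fin 3) => γ • v) + fun x => G x v) =
        fun x => (γ • ContinuousLinearMap.id ℝ (EuclideanSpace ℝ (Fin 3)) + G x) v := by
      funext x; simp
    rw [e] at h
    exact h
  -- the three pieces
  have hsq : HasWeakFDerivOn U volume (fun x => ‖selfSimilarTransport γ 0 V x‖ ^ 2)
      (fun x => (2 : ℝ) • (innerSL ℝ (selfSimilarTransport γ 0 V x)).comp
        (γ • ContinuousLinearMap.id ℝ (EuclideanSpace ℝ (Fin 3)) + G x)) :=
    hasWeakFDerivOn_norm_sq hW2 hWU hDW2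
  have hPU : HasWeakFDerivOn U volume P (fun x => -(innerSL ℝ (G x (selfSimilarTransport γ 0 V x) + (1 - γ) • V x))) :=
    HasWeakFDerivOn.mono_set_holds hP le_top
  have hysq : HasWeakFDerivOn U volume (fun x : EuclideanSpace ℝ (Fin 3) => ‖x‖ ^ 2) (fun x => (2 : ℝ) • innerSL ℝ x) := by
    have h := HasWeakFDerivOn.of_contDiff_holds U (volume : Measure (EuclideanSpace ℝ (Fin 3)))
      ((contDiff_norm_sq ℝ (n := 1) (E := EuclideanSpace ℝ (Fin 3))))
    have e : (fderiv ℝ fun x : EuclideanSpace ℝ (Fin 3) => ‖x‖ ^ 2) = fun x => (2 : ℝ) • innerSL ℝ x := by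
      funext x
      rw [(hasStrictFDerivAt_norm_sq x).hasFDerivAt.fderiv, two_smul, two_smul]
    rw [e] at h
    exact h
  -- combine
  have hcomb := ((hsq.const_smul (1 / 2 : ℝ)).sub (hPU.const_smul (-1 : ℝ))).sub (hysq.const_smul (-(γ * (γ - 1) / 2)))
  rw [← bernoulli_eq_smul_add] at hcomb
  have e : ((1 / 2 : ℝ) • (fun x => (2 : ℝ) • (innerSL ℝ (selfSimilarTransport γ 0 V x)).comp
        (γ • ContinuousLinearMap.id ℝ (EuclideanSpace ℝ (Fin 3)) + G x)) -
      (-1 : ℝ) • (fun x => -(innerSL ℝ (G x (selfSimilarTransport γ 0 V x) + (1 - γ) • V x))) -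
      (-(γ * (γ - 1) / 2)) • fun x : EuclideanSpace ℝ (Fin 3) => (2 : ℝ) • innerSL ℝ x) =
      fun x => (2 * γ - 1) • innerSL ℝ (selfSimilarTransport γ 0 V x) +
        (innerSL ℝ (selfSimilarTransport γ 0 V x)).comp (G x) - innerSL ℝ (G x (selfSimilarTransport γ 0 V x)) := by
    funext x
    ext v
    simp only [Pi.sub_apply, Pi.smul_apply, _root_.sub_apply, _root_.add_apply, _root_.smul_apply, _root_.neg_apply,
      ContinuousLinearMap.comp_apply, ContinuousLinearMap.coe_id', id_eq,
      innerSL_apply_apply, smul_eq_mul, map_add, map_smul]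
    rw [Logistic.inner_selfSimilarTransport_left γ V x v]
    ring
  rw [e] at hcomb
  exact hcomb

/-- **THE LAMB FORM (3.29) IN THE WEAK CLASS.**  Let `V ∈ L⁶(B(0,r))` for every `r`, with whole-space weak gradient `G`, `G ∈ L²(B(0,r))` for every
`r`, and let the pressure satisfy the weak pressure-gradient law `HasWeakFDerivOn ⊤ volume P (x ↦ −⟪G x (W x) + (1−γ)V x, ·⟫)` (the conclusion of
`WeakPressure.hasWeakFDerivOn_pressure`).  Then the similarity-Bernoulli function `ℋ = selfSimilarBernoulli γ 0 V P` is weakly differentiable on `ℝ³`: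
`Dℋ(x) v = (2γ−1)⟪W x, v⟫ + ⟪W x, G x v⟫ − ⟪G x (W x), v⟫`, i.e. `∇ℋ = −(1−2γ)W − (G − Gᵀ)W = −(1−2γ)W − Ω × W` a.e. — CIV (3.29) with NO regularity.
[folklore; cf. ConstantinIgnatovaVicol2026Putative §3.4.3 (3.29)] -/
theorem hasWeakFDerivOn_bernoulli {γ : ℝ}
    (hV6 : ∀ r : ℝ, MemLp V 6 (volume.restrict (ball (0 : EuclideanSpace ℝ (Fin 3)) r)))
    (hVG : HasWeakFDerivOn (⊤ : Opens (EuclideanSpace ℝ (Fin 3))) volume V G)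
    (hG2 : ∀ r : ℝ, MemLp G 2 (volume.restrict (ball (0 : EuclideanSpace ℝ (Fin 3)) r)))
    (hP : HasWeakFDerivOn (⊤ : Opens (EuclideanSpace ℝ (Fin 3))) volume P
      (fun x => -(innerSL ℝ (G x (selfSimilarTransport γ 0 V x) + (1 - γ) • V x)))) :
    HasWeakFDerivOn (⊤ : Opens (EuclideanSpace ℝ (Fin 3))) volume (selfSimilarBernoulli γ 0 V P)
      (fun x => (2 * γ - 1) • innerSL ℝ (selfSimilarTransport γ 0 V x) +
        (innerSL ℝ (selfSimilarTransport γ 0 V x)).comp (G x) - innerSL ℝ (G x (selfSimilarTransport γ 0 V x))) := by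
  have hball := fun R : ℝ => hasWeakFDerivOn_bernoulli_ball (γ := γ) hV6 hVG hG2 hP R
  have hxball : ∀ x : EuclideanSpace ℝ (Fin 3), x ∈ ball (0 : EuclideanSpace ℝ (Fin 3)) (‖x‖ + 1) := fun x => by
    rw [mem_ball, dist_zero_right]; linarith
  refine ⟨?_, ?_, fun φ v hφ => ?_⟩
  · rw [Opens.coe_top, locallyIntegrableOn_univ]
    intro x
    have h : IntegrableAtFilter (selfSimilarBernoulli γ 0 V P) (𝓝[ball (0 : EuclideanSpace ℝ (Fin 3)) (‖x‖ + 1)] x) volume :=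
      (hball (‖x‖ + 1)).locallyIntegrableOn x (hxball x)
    rwa [isOpen_ball.nhdsWithin_eq (hxball x)] at h
  · rw [Opens.coe_top, locallyIntegrableOn_univ]
    intro x
    have h : IntegrableAtFilter (fun x => (2 * γ - 1) • innerSL ℝ (selfSimilarTransport γ 0 V x) +
        (innerSL ℝ (selfSimilarTransport γ 0 V x)).comp (G x) - innerSL ℝ (G x (selfSimilarTransport γ 0 V x)))
        (𝓝[ball (0 : EuclideanSpace ℝ (Fin 3)) (‖x‖ + 1)] x) volume :=
      (hball (‖x‖ + 1)).locallyIntegrableOn_deriv x (hxball x)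
    rwa [isOpen_ball.nhdsWithin_eq (hxball x)] at h
  · obtain ⟨R₀, hR₀⟩ := hφ.hasCompactSupport.isCompact.isBounded.subset_ball (0 : EuclideanSpace ℝ (Fin 3))
    have hφU : IsTestFunctionOn (⟨ball (0 : EuclideanSpace ℝ (Fin 3)) R₀, isOpen_ball⟩ : Opens (EuclideanSpace ℝ (Fin 3))) φ :=
      ⟨hφ.contDiff, hφ.hasCompactSupport, hR₀⟩
    have h := (hball R₀).integral_fderiv_smul_eq φ v hφU
    have hK : ∀ x, x ∉ ball (0 : EuclideanSpace ℝ (Fin 3)) R₀ → x ∉ tsupport φ := fun x hx h' => hx (hR₀ h')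
    have e1 : ∫ x in ball (0 : EuclideanSpace ℝ (Fin 3)) R₀, fderiv ℝ φ x v • selfSimilarBernoulli γ 0 V P x =
        ∫ x, fderiv ℝ φ x v • selfSimilarBernoulli γ 0 V P x :=
      setIntegral_eq_integral_of_forall_compl_eq_zero fun x hx => by
        rw [fderiv_of_notMem_tsupport ℝ (hK x hx), _root_.zero_apply, zero_smul]
    have e2 : ∫ x in ball (0 : EuclideanSpace ℝ (Fin 3)) R₀, φ x • ((2 * γ - 1) • innerSL ℝ (selfSimilarTransport γ 0 V x) +
          (innerSL ℝ (selfSimilarTransport γ 0 V x)).comp (G x) - innerSL ℝ (G x (selfSimilarTransport γ 0 V x))) v =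
        ∫ x, φ x • ((2 * γ - 1) • innerSL ℝ (selfSimilarTransport γ 0 V x) +
          (innerSL ℝ (selfSimilarTransport γ 0 V x)).comp (G x) - innerSL ℝ (G x (selfSimilarTransport γ 0 V x))) v :=
      setIntegral_eq_integral_of_forall_compl_eq_zero fun x hx => by
        rw [image_eq_zero_of_notMem_tsupport (hK x hx), zero_smul]
    rw [Opens.coe_top, Measure.restrict_univ, ← e1, ← e2]
    exact h

/-! ## Member level -/

/-- **THE LAMB FORM OF A PAST-EXACT SELF-SIMILAR CLASS MEMBER** (`0 < ρ ≤ ½`, `γ = 1/(2+ρ)`; NO regularity of the profile): crux hypotheses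
verbatim, exact self-similarity about `(T, x₀)` for `τ < T₁` (`T₁ ≤ 0`, `T₁ ≤ T`) ⇒ there is a whole-space weak derivative `G` of `V`, `L²` on every
ball, such that `ℋ = selfSimilarBernoulli γ 0 V P` is weakly differentiable on `ℝ³` with `Dℋ(x) v = (2γ−1)⟪W x, v⟫ + ⟪W x, G x v⟫ − ⟪G x (W x), v⟫`.
[folklore] -/
theorem hasWeakFDerivOn_bernoulli_of_past {ρ : ℝ} (hρ : 0 < ρ) (hρh : ρ ≤ 1 / 2)
    {T T₁ : ℝ} (hT₁ : T₁ ≤ 0) (hTT₁ : T₁ ≤ T) (x₀ : EuclideanSpace ℝ (Fin 3))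
    {u : ℝ → EuclideanSpace ℝ (Fin 3) → EuclideanSpace ℝ (Fin 3)} {p : ℝ → EuclideanSpace ℝ (Fin 3) → ℝ}
    {H : ℝ → EuclideanSpace ℝ (Fin 3) → EuclideanSpace ℝ (Fin 3) →L[ℝ] EuclideanSpace ℝ (Fin 3)} {c : ℝ≥0}
    (hsw : IsSuitableWeakSolutionOn (slab (EuclideanSpace ℝ (Fin 3)) (Iio 0) isOpen_Iio) 0 0 u p)
    (hH : HasWeakSpatialGradientOn (slab (EuclideanSpace ℝ (Fin 3)) (Iio 0) isOpen_Iio) u H)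
    (hgauge : ∀ a : ℝ, 0 < a →
      ENNReal.ofReal (a ^ (2 * ρ)) * cknA a (0 : ℝ × EuclideanSpace ℝ (Fin 3)) u +
          ENNReal.ofReal (a ^ ρ) * cknE a (0 : ℝ × EuclideanSpace ℝ (Fin 3)) H +
        ENNReal.ofReal (a ^ (2 * ρ)) * cknD a (0 : ℝ × EuclideanSpace ℝ (Fin 3)) p ≤ (c : ℝ≥0∞))
    {V : EuclideanSpace ℝ (Fin 3) → EuclideanSpace ℝ (Fin 3)} {P : EuclideanSpace ℝ (Fin 3) → ℝ}
    (hu : ∀ τ : ℝ, τ < T₁ → u τ = fun x => selfSimilarCollapse (1 / (2 + ρ)) T V τ (x - x₀))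
    (hp : ∀ τ : ℝ, τ < T₁ → p τ = fun x => selfSimilarCollapsePressure (1 / (2 + ρ)) T P τ (x - x₀)) :
    ∃ G : EuclideanSpace ℝ (Fin 3) → EuclideanSpace ℝ (Fin 3) →L[ℝ] EuclideanSpace ℝ (Fin 3),
      HasWeakFDerivOn (⊤ : Opens (EuclideanSpace ℝ (Fin 3))) volume V G ∧
      (∀ r : ℝ, MemLp G 2 (volume.restrict (ball (0 : EuclideanSpace ℝ (Fin 3)) r))) ∧
      HasWeakFDerivOn (⊤ : Opens (EuclideanSpace ℝ (Fin 3))) volume (selfSimilarBernoulli (1 / (2 + ρ)) 0 V P)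
        (fun x => (2 * (1 / (2 + ρ)) - 1) • innerSL ℝ (selfSimilarTransport (1 / (2 + ρ)) 0 V x) +
          (innerSL ℝ (selfSimilarTransport (1 / (2 + ρ)) 0 V x)).comp (G x) -
          innerSL ℝ (G x (selfSimilarTransport (1 / (2 + ρ)) 0 V x))) := by
  have hA : ∀ a : ℝ, 0 < a → ENNReal.ofReal (a ^ (2 * ρ)) *
      cknA a (0 : ℝ × EuclideanSpace ℝ (Fin 3)) u ≤ (c : ℝ≥0∞) :=
    fun a ha => le_trans (le_trans le_self_add le_self_add) (hgauge a ha)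
  have hE : ∀ a : ℝ, 0 < a → ENNReal.ofReal (a ^ ρ) *
      cknE a (0 : ℝ × EuclideanSpace ℝ (Fin 3)) H ≤ (c : ℝ≥0∞) :=
    fun a ha => le_trans (le_trans le_add_self le_self_add) (hgauge a ha)
  have hD : ∀ a : ℝ, 0 < a → ENNReal.ofReal (a ^ (2 * ρ)) *
      cknD a (0 : ℝ × EuclideanSpace ℝ (Fin 3)) p ≤ (c : ℝ≥0∞) :=
    fun a ha => le_trans le_add_self (hgauge a ha)
  obtain ⟨G, hVm, hPm, -, hVG, -, -, -, -, hV6, hG2, hP32, hdiv, heq, -, -⟩ :=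
    Past.profileData_of_past hρ hρh hT₁ hTT₁ x₀ hsw.distributional hH hA hE hD hu hp
  exact ⟨G, hVG, hG2, hasWeakFDerivOn_bernoulli hV6 hVG hG2
    (WeakPressure.hasWeakFDerivOn_pressure hVm hPm hV6 hVG hG2 hP32 hdiv heq)⟩

/-- **THE LAMB FORM OF AN EXACTLY SELF-SIMILAR CLASS MEMBER (origin-centred; binder shape of the skeleton's `IsExactlySelfSimilar`).**
Crux hypotheses verbatim, `0 < ρ ≤ ½`, `u(τ) = selfSimilarCollapse γ 0 V τ`, `p(τ) = selfSimilarCollapsePressure γ 0 P τ` for `τ < 0`, `γ = 1/(2+ρ)`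
⇒ the weak profile's Bernoulli function is `W^{1,1}_loc` with the Lamb-form gradient `Dℋ(x) v = (2γ−1)⟪W x, v⟫ + ⟪W x, G x v⟫ − ⟪G x (W x), v⟫` for a
whole-space weak derivative `G` of `V`. [folklore] -/
theorem hasWeakFDerivOn_bernoulli_of_selfSimilar {ρ : ℝ} (hρ : 0 < ρ) (hρh : ρ ≤ 1 / 2)
    {u : ℝ → EuclideanSpace ℝ (Fin 3) → EuclideanSpace ℝ (Fin 3)} {p : ℝ → EuclideanSpace ℝ (Fin 3) → ℝ}
    {H : ℝ → EuclideanSpace ℝ (Fin 3) → EuclideanSpace ℝ (Fin 3) →L[ℝ] EuclideanSpace ℝ (Fin 3)} {c : ℝ≥0}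
    (hsw : IsSuitableWeakSolutionOn (slab (EuclideanSpace ℝ (Fin 3)) (Iio 0) isOpen_Iio) 0 0 u p)
    (hH : HasWeakSpatialGradientOn (slab (EuclideanSpace ℝ (Fin 3)) (Iio 0) isOpen_Iio) u H)
    (hgauge : ∀ a : ℝ, 0 < a →
      ENNReal.ofReal (a ^ (2 * ρ)) * cknA a (0 : ℝ × EuclideanSpace ℝ (Fin 3)) u +
          ENNReal.ofReal (a ^ ρ) * cknE a (0 : ℝ × EuclideanSpace ℝ (Fin 3)) H +
        ENNReal.ofReal (a ^ (2 * ρ)) * cknD a (0 : ℝ × EuclideanSpace ℝ (Fin 3)) p ≤ (c : ℝ≥0∞))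
    {V : EuclideanSpace ℝ (Fin 3) → EuclideanSpace ℝ (Fin 3)} {P : EuclideanSpace ℝ (Fin 3) → ℝ}
    (hu : ∀ τ : ℝ, τ < 0 → u τ = selfSimilarCollapse (1 / (2 + ρ)) 0 V τ)
    (hp : ∀ τ : ℝ, τ < 0 → p τ = selfSimilarCollapsePressure (1 / (2 + ρ)) 0 P τ) :
    ∃ G : EuclideanSpace ℝ (Fin 3) → EuclideanSpace ℝ (Fin 3) →L[ℝ] EuclideanSpace ℝ (Fin 3),
      HasWeakFDerivOn (⊤ : Opens (EuclideanSpace ℝ (Fin 3))) volume V G ∧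
      (∀ r : ℝ, MemLp G 2 (volume.restrict (ball (0 : EuclideanSpace ℝ (Fin 3)) r))) ∧
      HasWeakFDerivOn (⊤ : Opens (EuclideanSpace ℝ (Fin 3))) volume (selfSimilarBernoulli (1 / (2 + ρ)) 0 V P)
        (fun x => (2 * (1 / (2 + ρ)) - 1) • innerSL ℝ (selfSimilarTransport (1 / (2 + ρ)) 0 V x) +
          (innerSL ℝ (selfSimilarTransport (1 / (2 + ρ)) 0 V x)).comp (G x) -
          innerSL ℝ (G x (selfSimilarTransport (1 / (2 + ρ)) 0 V x))) := by
  have hu' : ∀ τ : ℝ, τ < 0 → u τ = fun x => selfSimilarCollapse (1 / (2 + ρ)) 0 V τ (x - 0) :=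
    fun τ hτ => by rw [hu τ hτ]; funext x; rw [sub_zero]
  have hp' : ∀ τ : ℝ, τ < 0 → p τ = fun x => selfSimilarCollapsePressure (1 / (2 + ρ)) 0 P τ (x - 0) :=
    fun τ hτ => by rw [hp τ hτ]; funext x; rw [sub_zero]
  exact hasWeakFDerivOn_bernoulli_of_past hρ hρh le_rfl le_rfl 0 hsw hH hgauge hu' hp'

end WeakBernoulli

end Summit.NavierStokesRegularity.NavierStokesRegularity.Theorems.PowerGaugeEulerLiouville
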